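import Summits.FinalStateConjecture.FinalStateConjecture.Theorems.EIHFluxBalanceInertialRecessionStubMomCapstonePointwise
import Summits.FinalStateConjecture.FinalStateConjecture.Theorems.EIHFluxBalanceInertialRecessionStubMomCapstoneSliceData

/-!
# Route EIHFluxBalance — `InertialRecession` (E′), line `SketchCleanExcision`, skeleton r13:
# registered stub `stub_momCapstone` (A) — the (M) clause of frozen-vacuum slaving

Helper file for the crux `stmt-FinalStateConjecture-17403`
(`Summit.FinalStateConjecture.FinalStateConjecture.Theses.EIHFluxBalance.InertialRecession`, E′).
FROZEN-VACUUM SLAVING: if `e + g₀` is a vacuum metric near every hole at late times (V) and `e → 0`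
in `C³` on the core-free late slabs (S), the painted moduli of the frozen multi-Kerr–Schild ansatz
`g₀ = η + Σᵢ (g_{Mᵢ,aᵢ} ∘ Λᵢ(x⁰)⁻¹(· − cᵢ(x⁰)) − η)` freeze. Its first-order step (stub D of r13)
consumes the present (M) CLAUSE: a smallness of the MOMENTUM rows `Ric(g₀)(x)(♯dx⁰, e_j)` that is
LINEAR in the first jet of the painted motion —

* `stub_momCapstone` — **under (V), (S), the kinematic clauses and the registered momentum-row
  lemma ML (`stub_momRowLinear`, a hypothesis): for every hole `i`, lab radius `R`, floor
  `r₀ ≥ rinᵢ` and `ε > 0` there is `T` such that at every point `x` of the late tube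
  `{x⁰ > T, ‖x̲ − ξᵢ(x⁰)‖ < R, rᵢ > r₀}` and every `l ≥ 1` with `‖Dg₀(x)‖ ≤ l`,
  `‖D²g₀(x)(w)‖ ≤ l‖w‖` (`w⁰ = 0`): `|Ric(g₀)(x)(♯_{g₀(x)}dx⁰, e_j)| ≤ ε l`, `j = 1, 2, 3`.**

Proof (no zoom): at a late tube point the `2`-jets of `g = e + g₀` and `g₀` differ by the jets of
`e`, of size `≤ δ` by (S); `g₀(x)` is `m/2`-coercive and bounded (`…StubSlaving12JetCompact`,
`…StubSlaving11AnsatzBound`) and its SLICE data are bounded independently of the motion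
(`momCap_sliceData_bound`, `…StubMomCapstoneSliceData`); `Ric(g)(x) = 0` by (V). The pointwise
jet-space estimate `momCap_jet_pointwise` (`…StubMomCapstonePointwise`: ML(ii) at the jet of `g` for
the normal part, the slice-Lipschitz estimate from ML(i) for the slice part) gives the claim once the
rows are read on jet space (`momCap_ricAt_sharp_eq_ricciJet_zero`). No definitions, no named facts,
no `sorry`.
-/

set_option linter.dupNamespace false
set_option maxSynthPendingDepth 6
set_option synthInstance.maxHeartbeats 200000

noncomputable section

namespace Summit.FinalStateConjecture.FinalStateConjecture.Theorems.SublinearIsFree.Slaving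

open scoped BigOperators Topology Manifold ContDiff ENNReal
open Filter Set Function TopologicalSpace Metric Literature.Geometry.Lorentzian
  Literature.Geometry.Lorentzian.MetricCoord
open Summit.FinalStateConjecture.FinalStateConjecture.Theorems

set_option maxHeartbeats 3200000 in
/-- **The (M) clause of frozen-vacuum slaving (registered stub `stub_momCapstone`, A of r13).**
Painted moduli with Lorentz factors `≤ γ`, smooth motions, separating centres, subextremal parameters
with `r₋ < rinᵢ < r₊`; a field `e` with (V) `e + g₀` vacuum metric components on every late
hole-following tube with floor `≥ rinᵢ` and (S) `C³`-small on the core-free late slabs; and the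
momentum-row lemma ML (registered statement of `stub_momRowLinear`, as a hypothesis). Then for every
hole `i`, `R`, `r₀ ≥ rinᵢ`, `ε > 0` there is `T` with: at every `x` of the tube
`{x⁰ > T, ‖x̲ − ξᵢ(x⁰)‖ < R, rᵢ > r₀}` and every `l ≥ 1` with `‖Dg₀(x)‖ ≤ l`, `‖D²g₀(x)(w)‖ ≤ l‖w‖`
for spatial `w`: `|Ric(g₀)(x)(♯dx⁰, e_j)| ≤ ε l` (jets of `e` small by (S), coercivity and
boundedness of `g₀(x)`, jet-free slice data `momCap_sliceData_bound`, vacuum `Ric(e + g₀)(x) = 0`,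
and the pointwise jet-space estimate `momCap_jet_pointwise`). [folklore] -/
theorem stub_momCapstone :
    ∀ (N : ℕ) (M a rin : Fin N → ℝ) (Λ : Fin N → ℝ → lorentzGroup) (ξ : Fin N → ℝ → E3) (γ : ℝ) (e : E4 → E4 →L[ℝ] E4 →L[ℝ] ℝ), (∀ i, Kerr.IsSubextremal (M i) (a i) ∧ Kerr.rMinus (M i) (a i) < rin i ∧ rin i < Kerr.rPlus (M i) (a i)) → (∀ i t, |((Λ i t : E4 ≃L[ℝ] E4) (E4.basisVector 0)) 0| ≤ γ) → (∀ i, ContDiff ℝ ((⊤ : ℕ∞) : WithTop ℕ∞) (ξ i) ∧ ContDiff ℝ ((⊤ : ℕ∞) : WithTop ℕ∞) (fun t ↦ ((Λ i t : E4 ≃L[ℝ] E4) : E4 →L[ℝ] E4))) → (∀ i j, i ≠ j → Tendsto (fun t ↦ ‖ξ i t - ξ j t‖) atTop atTop) → (∀ (i : Fin N) (R r₀ : ℝ), rin i ≤ r₀ → ∃ T : ℝ, MetricCoord.IsMetricOn (fun z : E4 ↦ e z + (Minkowski.bilin + ∑ i, (boostedKerrBilin (Λ i (z 0)) (E4.ofTimeSpace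 (z 0) (ξ i (z 0))) (M i) (a i) z - Minkowski.bilin))) {x : E4 | T < x 0 ∧ ‖E4.spatial x - ξ i (x 0)‖ < R ∧ r₀ < Kerr.radius (a i) (poincareInv (Λ i (x 0)) (E4.ofTimeSpace (x 0) (ξ i (x 0))) x)} ∧ ∀ x : E4, T < x 0 → ‖E4.spatial x - ξ i (x 0)‖ < R → r₀ < Kerr.radius (a i) (poincareInv (Λ i (x 0)) (E4.ofTimeSpace (x 0) (ξ i (x 0))) x) → (∀ j, rin j < Kerr.radius (a j) (poincareInv (Λ j (x 0)) (E4.ofTimeSpace (x 0) (ξ j (x 0))) x)) ∧ MetricCoord.ricAt (fun z : E4 ↦ e z + (Minkowski.bilin + ∑ i, (boostedKerrBilin (Λ i (z 0)) (E4.ofTimeSpace (z 0) (ξ i (z 0))) (M i) (a i) z - Minkowski.bilin))) x = 0) → Tendsto (fun t : ℝ ↦ supCkENorm {x : E4 | x 0 = t ∧ ∀ j, rin j < Kerr.radius (a j) (poincareInv (Λ j (x 0)) (E4.ofTimeSpace (x 0) (ξ j (x 0))) x)} 3 e) atTop (𝓝 0) → (∀ {G G₁ G₂ G₃ : E4 →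 E4 →L[ℝ] E4 →L[ℝ] ℝ} {V : Set E4} {x : E4} {n : E4 →L[ℝ] ℝ} {A₁ A₂ : E4 →L[ℝ] E4 →L[ℝ] ℝ} {P₁ P₂ : E4 →L[ℝ] E4 →L[ℝ] E4 →L[ℝ] ℝ} {W₁ W₂ W₃ : E4 →L[ℝ] E4 →L[ℝ] ℝ} (c₁ c₂ : ℝ), MetricCoord.IsMetricOn G V → MetricCoord.IsMetricOn G₁ V → MetricCoord.IsMetricOn G₂ V → MetricCoord.IsMetricOn G₃ V → x ∈ V → G₁ x = G x → G₂ x = G x → G₃ x = G x → fderiv ℝ G₁ x = fderiv ℝ G x + n.smulRight A₁ → fderiv ℝ G₂ x = fderiv ℝ G x + n.smulRight A₂ → fderiv ℝ G₃ x = fderiv ℝ G x + n.smulRight (c₁ • A₁ + c₂ • A₂) → (∀ v, fderiv ℝ (fderiv ℝ G₁) x v = fderiv ℝ (fderiv ℝ G) x v + (n v • P₁ + n.smulRight (P₁ v) + n v • n.smulRight W₁)) → (∀ v, fderiv ℝ (fderiv ℝ G₂) x v = fderiv ℝ (fderiv ℝ G) x v + (n v • P₂ + n.smulRight (P₂ v)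 + n v • n.smulRight W₂)) → (∀ v, fderiv ℝ (fderiv ℝ G₃) x v = fderiv ℝ (fderiv ℝ G) x v + (n v • (c₁ • P₁ + c₂ • P₂) + n.smulRight ((c₁ • P₁ + c₂ • P₂) v) + n v • n.smulRight W₃)) → ∀ e : E4, n e = 0 → MetricCoord.ricAt G₃ x (MetricCoord.sharpAt G x n) e - MetricCoord.ricAt G x (MetricCoord.sharpAt G x n) e = c₁ * (MetricCoord.ricAt G₁ x (MetricCoord.sharpAt G x n) e - MetricCoord.ricAt G x (MetricCoord.sharpAt G x n) e) + c₂ * (MetricCoord.ricAt G₂ x (MetricCoord.sharpAt G x n) e - MetricCoord.ricAt G x (MetricCoord.sharpAt G x n) e)) ∧ (∀ μ ν : ℝ, 0 < μ → ∃ C : ℝ, ∀ {G G₁ : E4 → E4 →L[ℝ] E4 →L[ℝ] ℝ} {V : Set E4} {x : E4} {n : E4 →L[ℝ] ℝ} {A : E4 →L[ℝ] E4 →L[ℝ] ℝ} {P : E4 →L[ℝ] E4 →L[ℝ] E4 →L[ℝ] ℝ} {W : E4 →L[ℝ] E4 →L[ℝ] ℝ}, MetricCoord.IsMetricOn G V →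 MetricCoord.IsMetricOn G₁ V → x ∈ V → (∀ v : E4, μ * ‖v‖ ≤ ‖G x v‖) → ‖G x‖ ≤ ν → G₁ x = G x → fderiv ℝ G₁ x = fderiv ℝ G x + n.smulRight A → (∀ v, fderiv ℝ (fderiv ℝ G₁) x v = fderiv ℝ (fderiv ℝ G) x v + (n v • P + n.smulRight (P v) + n v • n.smulRight W)) → ∀ e : E4, n e = 0 → |MetricCoord.ricAt G₁ x (MetricCoord.sharpAt G x n) e - MetricCoord.ricAt G x (MetricCoord.sharpAt G x n) e| ≤ C * (1 + ‖fderiv ℝ G x‖) * (‖A‖ + ‖P‖) * ‖n‖ ^ 2 * ‖e‖) → (∀ (i : Fin N) (R r₀ : ℝ), rin i ≤ r₀ → ∀ ε : ℝ, 0 < ε → ∃ T : ℝ, ∀ x : E4, T < x 0 → ‖E4.spatial x - ξ i (x 0)‖ < R → r₀ < Kerr.radius (a i) (poincareInv (Λ i (x 0)) (E4.ofTimeSpace (x 0) (ξ i (x 0))) x) → ∀ l : ℝ, 1 ≤ l → ‖fderiv ℝ (fun z : E4 ↦ Minkowski.bilin + ∑ i, (boostedKerrBilin (Λ i (z 0))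 (E4.ofTimeSpace (z 0) (ξ i (z 0))) (M i) (a i) z - Minkowski.bilin)) x‖ ≤ l → (∀ w : E4, w 0 = 0 → ‖fderiv ℝ (fderiv ℝ (fun z : E4 ↦ Minkowski.bilin + ∑ i, (boostedKerrBilin (Λ i (z 0)) (E4.ofTimeSpace (z 0) (ξ i (z 0))) (M i) (a i) z - Minkowski.bilin))) x w‖ ≤ l * ‖w‖) → ∀ j : Fin 3, |MetricCoord.ricAt (fun z : E4 ↦ Minkowski.bilin + ∑ i, (boostedKerrBilin (Λ i (z 0)) (E4.ofTimeSpace (z 0) (ξ i (z 0))) (M i) (a i) z - Minkowski.bilin)) x (MetricCoord.sharpAt (fun z : E4 ↦ Minkowski.bilin + ∑ i, (boostedKerrBilin (Λ i (z 0)) (E4.ofTimeSpace (z 0) (ξ i (z 0))) (M i) (a i) z - Minkowski.bilin)) x (E4.dx 0)) (E4.basisVector j.succ)| ≤ ε * l) := by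
  intro N M a rin Λ ξ γ e h1 hγ hsm hsep hV hS hML i R r₀ hr₀ ε hε
  set g₀ : E4 → E4 →L[ℝ] E4 →L[ℝ] ℝ := (fun z : E4 ↦ Minkowski.bilin + ∑ i, (boostedKerrBilin (Λ i (z 0)) (E4.ofTimeSpace (z 0) (ξ i (z 0))) (M i) (a i) z - Minkowski.bilin)) with hg₀
  -- sizes
  have hrin : ∀ j, 0 < rin j := fun j ↦ (h1 j).1.rMinus_nonneg.trans_lt (h1 j).2.1
  have hr₀' : 0 < r₀ := (hrin i).trans_le hr₀
  have hγ1 : 1 ≤ γ := (one_le_abs_lorentz_apply_zero (Λ i 0)).trans (hγ i 0)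
  have hK₀ : 0 < (1 + 3 * γ) ^ 2 * (1 + 4 * (|M i| / r₀)) :=
    mul_pos (pow_pos (by linarith) 2) (by positivity)
  set m : ℝ := ((1 + 3 * γ) ^ 2 * (1 + 4 * (|M i| / r₀)))⁻¹ with hm
  have hm0 : 0 < m := inv_pos.2 hK₀
  set α : ℝ := ‖(Minkowski.bilin : E4 →L[ℝ] E4 →L[ℝ] ℝ)‖ +
    ∑ j, 4 * (|M j| / min r₀ 1) * (1 + 3 * γ) ^ 2 with hα
  -- jet-free bounds for the slice data, and the pointwise threshold
  obtain ⟨Csp, hCsp0, hCsp⟩ := momCap_sliceData_bound M a rin hrin γ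
  obtain ⟨δ, hδ0, hδ⟩ := momCap_jet_pointwise hML.1 hML.2 (α := α) hm0 hCsp0 hε
  -- late times
  obtain ⟨T₁, hG₁, hvac⟩ := hV i R r₀ hr₀
  have E1 := eventually_ansatz_coercive_near_hole (M := M) (a := a) hγ hsep i R hr₀'
  have E2 := eventually_norm_ansatz_le_near_hole (M := M) (a := a) hγ hsep i R hr₀'
  have E3 : ∀ᶠ t in atTop, supCkENorm {x : E4 | x 0 = t ∧ ∀ j, rin j < Kerr.radius (a j) (poincareInv (Λ j (x 0)) (E4.ofTimeSpace (x 0) (ξ j (x 0))) x)} 3 e < ENNReal.ofReal δ :=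
    (tendsto_order.1 hS).2 _ (ENNReal.ofReal_pos.2 hδ0)
  obtain ⟨T₂, hT₂⟩ := eventually_atTop.1 ((E1.and E2).and E3)
  refine ⟨max T₁ T₂, fun x hxT hxR hxr l hl hD1 hD2 j ↦ ?_⟩
  have hxT₁ : T₁ < x 0 := (le_max_left _ _).trans_lt hxT
  have hxT₂ : T₂ < x 0 := (le_max_right _ _).trans_lt hxT
  -- the open neighbourhood `A` of `x`
  set A : Set E4 := {z : E4 | T₁ < z 0 ∧ ‖E4.spatial z - ξ i (z 0)‖ < R ∧ r₀ < Kerr.radius (a i) (poincareInv (Λ i (z 0)) (E4.ofTimeSpace (z 0) (ξ i (z 0))) z)} ∩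
    {z : E4 | T₂ < z 0} with hA
  have hAo : IsOpen A :=
    hG₁.isOpen.inter (isOpen_lt continuous_const (EuclideanSpace.proj (0 : Fin 4)).continuous)
  have hxA : x ∈ A := ⟨⟨hxT₁, hxR, hxr⟩, hxT₂⟩
  have hfacts : ∀ z ∈ A, (∀ j, 0 < Kerr.radius (a j) (poincareInv (Λ j (z 0)) (E4.ofTimeSpace (z 0) (ξ j (z 0))) z)) ∧ (∀ v : E4, m / 2 * ‖v‖ ≤ ‖g₀ z v‖) ∧ ‖g₀ z‖ ≤ α ∧
      (∀ j, rin j < Kerr.radius (a j) (poincareInv (Λ j (z 0)) (E4.ofTimeSpace (z 0) (ξ j (z 0))) z)) ∧ ricAt (fun w ↦ e w + g₀ w) z = 0 := by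
    intro z hz
    obtain ⟨⟨hzT₁, hzR, hzr⟩, hzT₂⟩ := hz
    obtain ⟨⟨h1', h2'⟩, -⟩ := hT₂ (z 0) hzT₂.le
    obtain ⟨hr, hc⟩ := h1' z rfl hzR.le hzr.le
    obtain ⟨hcore, hric⟩ := hvac z hzT₁ hzR hzr
    exact ⟨hr, hc, h2' z rfl hzR.le hzr.le, hcore, hric⟩
  -- metric components on `A`
  have hG : IsMetricOn (fun w ↦ e w + g₀ w) A :=
    ⟨hAo, hG₁.contDiffOn.mono inter_subset_left, fun z hz v w ↦ hG₁.symm z hz.1 v w,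
      fun z hz ↦ hG₁.isInvertible z hz.1⟩
  have hG' : IsMetricOn g₀ A := by
    refine ⟨hAo, fun z hz ↦ ?_, fun z _ v w ↦ ?_, fun z hz ↦ ?_⟩
    · exact (contDiffAt_ansatzBilin' N M a Λ ξ (fun j ↦ (hsm j).2) (fun j ↦ (hsm j).1) z
        (hfacts z hz).1).contDiffWithinAt
    · show (Minkowski.bilin + ∑ i, (boostedKerrBilin (Λ i (z 0)) (E4.ofTimeSpace (z 0) (ξ i (z 0)))
        (M i) (a i) z - Minkowski.bilin)) v w = (Minkowski.bilin + ∑ i, (boostedKerrBilin (Λ i (z 0))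
        (E4.ofTimeSpace (z 0) (ξ i (z 0))) (M i) (a i) z - Minkowski.bilin)) w v
      simp only [add_apply, FunLike.coe_sum, Finset.sum_apply,
        sub_apply, Minkowski.bilin_symm v w, boostedKerrBilin_symm _ _ _ _ z v w]
    · refine MetricCoord.isInvertible_of_nondegenerate fun v hv ↦ ?_
      have h0 : g₀ z v = 0 := ContinuousLinearMap.ext fun w ↦ hv w
      have h1' := (hfacts z hz).2.1 v
      rw [h0, norm_zero] at h1'
      have h2 : ‖v‖ ≤ 0 := by nlinarith [norm_nonneg v]
      exact norm_le_zero_iff.1 h2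
  have he : ContDiffOn ℝ ∞ e A := by
    have hex : e = fun z ↦ (e z + g₀ z) - g₀ z := funext fun z ↦ (add_sub_cancel_right _ _).symm
    rw [hex]
    exact hG.contDiffOn.sub hG'.contDiffOn
  -- jets of the sum `e + g₀` at `x`
  have hSum := fderiv_add_jets he hG'.contDiffOn hAo hxA
  -- facts at `x`
  obtain ⟨-, hxc, hxα, hxcore, hricx⟩ := hfacts x hxA
  obtain ⟨-, hE3x⟩ := hT₂ (x 0) hxT₂.le
  have hmem : x ∈ {y : E4 | y 0 = x 0 ∧ ∀ j, rin j < Kerr.radius (a j) (poincareInv (Λ j (y 0)) (E4.ofTimeSpace (y 0) (ξ j (y 0))) y)} := ⟨rfl, hxcore⟩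
  have hdevk : ∀ k ≤ 3, ‖iteratedFDeriv ℝ k e x‖ ≤ δ := by
    intro k hk
    have h1' := enorm_iteratedFDeriv_le_supCkENorm hk hmem e
    rw [← ofReal_norm] at h1'
    exact ((ENNReal.ofReal_lt_ofReal_iff hδ0).1 (h1'.trans_lt hE3x)).le
  have hd0 : ‖e x‖ ≤ δ := by
    rw [← norm_iteratedFDeriv_zero (𝕜 := ℝ)]; exact hdevk 0 (by norm_num)
  have hd1 : ‖fderiv ℝ e x‖ ≤ δ := by
    rw [(norm_fderiv_eq_norm_iteratedFDeriv e x).1]; exact hdevk 1 (by norm_num)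
  have hd2 : ‖fderiv ℝ (fderiv ℝ e) x‖ ≤ δ := by
    rw [(norm_fderiv_eq_norm_iteratedFDeriv e x).2]; exact hdevk 2 (by norm_num)
  -- the differences of the jets of `g = e + g₀` and `g₀` at `x` are the jets of `e`
  have hD0' : ‖(fun w ↦ e w + g₀ w) x - g₀ x‖ ≤ δ := by
    simp only [add_sub_cancel_right]; exact hd0
  have hD1' : ‖fderiv ℝ (fun w ↦ e w + g₀ w) x - fderiv ℝ g₀ x‖ ≤ δ := by
    rw [hSum.1, add_sub_cancel_right]; exact hd1
  have hD2' : ‖fderiv ℝ (fderiv ℝ (fun w ↦ e w + g₀ w)) x - fderiv ℝ (fderiv ℝ g₀) x‖ ≤ δ := by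
    rw [hSum.2.1, add_sub_cancel_right]; exact hd2
  -- the slice data of `g₀` at `x`
  obtain ⟨hS1, hS2⟩ := hCsp Λ ξ hγ hsm hAo hxA (fun z hz j ↦ ((hfacts z hz).2.2.2.1 j).le)
  -- vacuum at `x`, read on jet space
  have h0 : ricciJet ((0 : E4), (fun w ↦ e w + g₀ w) x, fderiv ℝ (fun w ↦ e w + g₀ w) x,
      fderiv ℝ (fderiv ℝ (fun w ↦ e w + g₀ w)) x) = 0 :=
    (momCap_ricAt_eq_ricciJet_zero hG hxA).symm.trans hricx
  -- the pointwise estimate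
  have key := hδ (hG.symm x hxA) (hG.isInvertible x hxA) (fun z v w ↦ hG.fderiv_symm hxA z v w)
    (fun z z' v w ↦ hG.fderiv_fderiv_symm hxA z z' v w) (fun v w ↦ hG.fderiv_fderiv_comm hxA v w)
    (hG'.symm x hxA) (hG'.isInvertible x hxA) (fun z v w ↦ hG'.fderiv_symm hxA z v w)
    (fun z z' v w ↦ hG'.fderiv_fderiv_symm hxA z z' v w) (fun v w ↦ hG'.fderiv_fderiv_comm hxA v w)
    h0 hxc hxα hS1 hS2 hD0' hD1' hD2' l hl hD1 hD2 j
  rw [momCap_ricAt_sharp_eq_ricciJet_zero hG' hxA]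
  exact key

end Summit.FinalStateConjecture.FinalStateConjecture.Theorems.SublinearIsFree.Slaving

end
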